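import Literature.Geometry.GeometricMeasureTheory.RectifiableVarifold
import Literature.Geometry.GeometricMeasureTheory.ApproxTangentChart
import HarnessLib

/-!
# The varifold `θ|S|` of an `m`-plane (Tonegawa 2019, §1.3 and Prop. 1.14)

Topic `Literature/Geometry/GeometricMeasureTheory`.  The basic example of a rectifiable varifold,
and the non-vacuity witness of the vocabulary of `RectifiableVarifold.lean`: for an
`m`-dimensional linear subspace `S` of the finite-dimensional inner product space `V` and a constant
multiplicity `0 < θ₀ < ∞`, the data `(S, θ₀, x ↦ P_S)` (`P_S` the orthogonal projection onto `S`) are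
admissible (`isRectifiableVarifoldData_subspace`) — the heart being that **the approximate tangent
cone of `H^m ⌞ S` at every point of `S` is `S` itself** (`approxTangentCone_restrict_subspace`,
Federer 3.2.19 in the tree's form `approxTangentCone_eq_range_fderiv`, applied to the isometric
parametrisation `planeChart : ℝᵐ → S` with its `1`-Lipschitz left inverse `planeRetraction`) — and
`Varifold.ofSubspace S hS θ₀ = θ₀|S|` is the corresponding rectifiable `m`-varifold on `V`
(Tonegawa 2019, §1.3, the example `V = θ|S|, S ∈ G(n, k)` of Prop. 1.14; with `θ₀ = 1` the
unit-density `|S|`, `isUnitDensity_ofSubspace_one`), whose weight is `θ₀ · μHE[m] ⌞ S`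
(`weight_ofSubspace`), a locally finite measure (`H^m ⌞ S` is the image of Lebesgue measure on `ℝᵐ`
under `planeChart`, `restrict_subspace_eq_map_planeChart`).

Also: `approxTangentCone_smul` (the cone of `c • μ` is that of `μ` for
`0 < c < ∞`), used to pass between the weight `θ₀ · H^m ⌞ S` and `H^m ⌞ S`.

## References

* [Tonegawa2019] Y. Tonegawa, *Brakke's Mean Curvature Flow*, SpringerBriefs 2019, §1.3 (Def. 1.6,
  the non-rectifiable example and `θ|S|`), §1.6, Prop. 1.14 — held copy
  `book:tonegawand-brakke-s-mean-curvature-flow`.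
* [Federer1969] H. Federer, *Geometric Measure Theory*, 1969, 3.2.16, 3.2.19.
-/

noncomputable section

open MeasureTheory Set Filter Topology Module
open scoped ENNReal NNReal Topology

namespace Literature.Geometry.GeometricMeasureTheory

/-! ### Scaling a measure does not change its approximate tangent cones -/

section Smul

variable {V : Type*} [NormedAddCommGroup V] [MeasurableSpace V] {m : ℕ}

/-- `Θ^{*m}(c • μ, a) = c Θ^{*m}(μ, a)` for `c < ∞` (a local copy of `upperDensity_smul` of
`RectifiableFrameRank.lean`, not imported here to keep this example file light). [folklore] -/
private theorem upperDensity_const_smul (μ : Measure V) {c : ℝ≥0∞} (hc : c ≠ ∞) (a : V) :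
    upperDensity m (c • μ) a = c * upperDensity m μ a := by
  unfold upperDensity
  rw [← ENNReal.limsup_const_mul_of_ne_top hc]
  congr 1
  funext r
  rw [Measure.smul_apply, smul_eq_mul, mul_div_assoc]

variable [NormedSpace ℝ V]

/-- **`Tan^m(c • μ, a) = Tan^m(μ, a)` for `0 < c < ∞`** (the defining densities scale by `c`).
[folklore] -/
theorem approxTangentCone_smul (μ : Measure V) {c : ℝ≥0∞} (h0 : c ≠ 0) (hc : c ≠ ∞) (a : V) :
    approxTangentCone m (c • μ) a = approxTangentCone m μ a := by
  ext v
  simp only [approxTangentCone, mem_iInter]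
  refine forall_congr' fun S ↦ ?_
  rw [Measure.restrict_smul, upperDensity_const_smul _ hc, mul_eq_zero, or_iff_right h0]

end Smul

/-! ### The isometric parametrisation of an `m`-plane and its `1`-Lipschitz retraction -/

section Plane

variable {V : Type*} [NormedAddCommGroup V] [InnerProductSpace ℝ V] [FiniteDimensional ℝ V]
  {m : ℕ} (S : Submodule ℝ V)

/-- An orthonormal basis of the `m`-plane `S` indexed by `Fin m`. [folklore] -/
def planeBasis (hS : finrank ℝ S = m) : OrthonormalBasis (Fin m) ℝ S :=
  (stdOrthonormalBasis ℝ S).reindex (finCongr hS)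

/-- **The isometric parametrisation `ℝᵐ → S ⊆ V` of an `m`-plane.** [folklore] -/
def planeChart (hS : finrank ℝ S = m) : EuclideanSpace ℝ (Fin m) →ₗᵢ[ℝ] V :=
  S.subtypeₗᵢ.comp (planeBasis S hS).repr.symm.toLinearIsometry

/-- Unfolding lemma. [folklore] -/
theorem planeChart_apply (hS : finrank ℝ S = m) (t : EuclideanSpace ℝ (Fin m)) :
    planeChart S hS t = ((planeBasis S hS).repr.symm t : V) := rfl

/-- The parametrisation lands in `S`. [folklore] -/
theorem planeChart_mem (hS : finrank ℝ S = m) (t : EuclideanSpace ℝ (Fin m)) :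
    planeChart S hS t ∈ S :=
  ((planeBasis S hS).repr.symm t).2

/-- The parametrisation is onto `S`. [folklore] -/
theorem range_planeChart (hS : finrank ℝ S = m) : range (planeChart S hS) = S := by
  ext x
  constructor
  · rintro ⟨t, rfl⟩
    exact planeChart_mem S hS t
  · intro hx
    refine ⟨(planeBasis S hS).repr ⟨x, hx⟩, ?_⟩
    rw [planeChart_apply, LinearIsometryEquiv.symm_apply_apply]

/-- **The `1`-Lipschitz left inverse** `V → ℝᵐ`: orthogonal projection onto `S` followed by the
coordinates in the orthonormal basis. [folklore] -/
def planeRetraction (hS : finrank ℝ S = m) : V → EuclideanSpace ℝ (Fin m) :=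
  fun z ↦ (planeBasis S hS).repr (S.orthogonalProjectionOnto z)

/-- The retraction is `1`-Lipschitz. [folklore] -/
theorem lipschitz_planeRetraction (hS : finrank ℝ S = m) :
    LipschitzWith 1 (planeRetraction S hS) := by
  have h1 : LipschitzWith 1 (S.orthogonalProjectionOnto : V → S) := by
    refine S.orthogonalProjectionOnto.lipschitz.weaken ?_
    rw [← NNReal.coe_le_coe, coe_nnnorm, NNReal.coe_one]
    exact S.orthogonalProjectionOnto_norm_le
  exact ((planeBasis S hS).repr.lipschitz.comp h1).weaken (by norm_num)

/-- The retraction is a left inverse of the parametrisation. [folklore] -/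
theorem planeRetraction_planeChart (hS : finrank ℝ S = m) (t : EuclideanSpace ℝ (Fin m)) :
    planeRetraction S hS (planeChart S hS t) = t := by
  simp [planeRetraction, planeChart_apply]

variable [MeasurableSpace V] [BorelSpace V]

/-- **The approximate tangent cone of an `m`-plane is the plane**: `Tan^m(H^m ⌞ S, x) = S` at every
`x ∈ S` (Federer 3.2.19, through the tree's `approxTangentCone_eq_range_fderiv` for the chart
`planeChart` with left inverse `planeRetraction`, the level-set map `z ↦ z - P_S z`).
[cite: Federer1969, 3.2.19] -/
theorem approxTangentCone_restrict_subspace (hS : finrank ℝ S = m) {x : V} (hx : x ∈ S) :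
    approxTangentCone m ((μHE[m] : Measure V).restrict S) x = S := by
  obtain ⟨t, rfl⟩ : x ∈ range (planeChart S hS) := by rwa [range_planeChart]
  have hC : planeChart S hS '' univ ⊆ (S : Set V) := by
    rintro _ ⟨s, -, rfl⟩
    exact planeChart_mem S hS s
  have hF := (ContinuousLinearMap.id ℝ V - S.starProjection).hasFDerivAt (x := planeChart S hS t)
  have key := approxTangentCone_eq_range_fderiv
    (lipschitz_planeRetraction S hS) (W := univ) univ_mem
    ((planeChart S hS).lipschitz.lipschitzOnWith (s := univ))
    (fun s _ ↦ planeRetraction_planeChart S hS s)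
    (planeChart S hS).toContinuousLinearMap.hasFDerivAt hC
    S.closed_of_finiteDimensional.measurableSet MeasurableSet.univ univ_mem hF ?_ ?_
  · rw [finrank_euclideanSpace_fin] at key
    rw [key]
    change range (planeChart S hS) = _
    exact range_planeChart S hS
  · rintro z ⟨hz, -⟩
    simp only [mem_setOf_eq, sub_apply, ContinuousLinearMap.id_apply]
    rw [Submodule.starProjection_eq_self_iff.2 hz,
      Submodule.starProjection_eq_self_iff.2 (planeChart_mem S hS t), sub_self, sub_self]
  · intro y hy
    have hyS : y ∈ S := by
      rw [sub_apply, ContinuousLinearMap.id_apply, sub_eq_zero] at hy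
      exact Submodule.starProjection_eq_self_iff.1 hy.symm
    change y ∈ range (planeChart S hS)
    rwa [range_planeChart]

/-- **`H^m ⌞ S` is the image of Lebesgue measure of `ℝᵐ` under the parametrisation** (Mathlib:
isometries push `μHE[m]` to `μHE[m] ⌞ range`, and `μHE[m] = volume` on `ℝᵐ`). [folklore] -/
theorem restrict_subspace_eq_map_planeChart (hS : finrank ℝ S = m) :
    ((μHE[m] : Measure V).restrict S) = (volume : Measure (EuclideanSpace ℝ (Fin m))).map
      (planeChart S hS) := by
  rw [← EuclideanSpace.euclideanHausdorffMeasure_eq_volume m,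
    (planeChart S hS).isometry.map_euclideanHausdorffMeasure, range_planeChart]

/-- **`H^m ⌞ S` is locally finite** for an `m`-plane `S`. [folklore] -/
theorem isLocallyFiniteMeasure_restrict_subspace (hS : finrank ℝ S = m) :
    IsLocallyFiniteMeasure ((μHE[m] : Measure V).restrict S) := by
  rw [restrict_subspace_eq_map_planeChart S hS]
  refine ⟨fun x ↦ ⟨Metric.ball x 1, Metric.ball_mem_nhds x one_pos, ?_⟩⟩
  rw [Measure.map_apply (planeChart S hS).continuous.measurable Metric.isOpen_ball.measurableSet]
  have hsub : planeChart S hS ⁻¹' Metric.ball x 1 ⊆ Metric.ball (planeRetraction S hS x) 1 := by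
    intro s hs
    rw [mem_preimage, Metric.mem_ball] at hs
    rw [Metric.mem_ball]
    calc dist s (planeRetraction S hS x)
        = dist (planeRetraction S hS (planeChart S hS s)) (planeRetraction S hS x) := by
          rw [planeRetraction_planeChart]
      _ ≤ dist (planeChart S hS s) x := by
          simpa using (lipschitz_planeRetraction S hS).dist_le_mul (planeChart S hS s) x
      _ < 1 := hs
  exact lt_of_le_of_lt (measure_mono hsub) measure_ball_lt_top

/-- **An `m`-plane with constant multiplicity `0 < θ₀ < ∞` is admissible data** `(S, θ₀, x ↦ P_S)`
for a rectifiable `m`-varifold (non-vacuity of `IsRectifiableVarifoldData`; Tonegawa 2019, §1.3: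
`θ|S|`). [cite: Tonegawa2019, Prop. 1.14, §1.6] -/
theorem isRectifiableVarifoldData_subspace (hS : finrank ℝ S = m) {θ₀ : ℝ≥0∞} (h0 : 0 < θ₀)
    (htop : θ₀ < ∞) :
    IsRectifiableVarifoldData m (S : Set V) (fun _ ↦ θ₀) (fun _ ↦ S.starProjection) := by
  refine ⟨S.closed_of_finiteDimensional.measurableSet, ?_, measurable_const, measurable_const, ?_⟩
  · rw [← range_planeChart S hS]
    exact IsCountablyRectifiable.range_of_lipschitz (planeChart S hS).lipschitz
  · filter_upwards [ae_restrict_mem S.closed_of_finiteDimensional.measurableSet] with x hx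
    refine ⟨h0, htop, starProjection_mem_grassmannian S hS, ?_⟩
    rw [withDensity_const, approxTangentCone_smul _ h0.ne' htop.ne,
      approxTangentCone_restrict_subspace S hS hx]
    change ((LinearMap.range (S.starProjection : V →ₗ[ℝ] V) : Submodule ℝ V) : Set V) = S
    rw [Submodule.range_starProjection]

omit [InnerProductSpace ℝ V] [FiniteDimensional ℝ V] [BorelSpace V] in
/-- A finite multiple of a locally finite measure is locally finite. [folklore] -/
theorem isLocallyFiniteMeasure_smul_of_ne_top {μ : Measure V} [IsLocallyFiniteMeasure μ] {c : ℝ≥0∞}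
    (hc : c ≠ ∞) : IsLocallyFiniteMeasure (c • μ) :=
  ⟨fun x ↦ by
    obtain ⟨N, hN, hμN⟩ := μ.finiteAt_nhds x
    refine ⟨N, hN, ?_⟩
    rw [Measure.smul_apply, smul_eq_mul]
    exact ENNReal.mul_lt_top hc.lt_top hμN⟩

/-- The measure `(x ↦ (x, P_S))_# (θ₀ · H^m ⌞ S)` of `θ₀|S|` is locally finite. [folklore] -/
theorem isLocallyFiniteMeasure_map_plane (hS : finrank ℝ S = m) (θ₀ : ℝ≥0) :
    IsLocallyFiniteMeasure (((((θ₀ : ℝ≥0∞) • (μHE[m] : Measure V).restrict S)).map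
      fun x ↦ (x, S.starProjection))) := by
  haveI := isLocallyFiniteMeasure_restrict_subspace S hS
  haveI : IsLocallyFiniteMeasure ((θ₀ : ℝ≥0∞) • (μHE[m] : Measure V).restrict S) :=
    isLocallyFiniteMeasure_smul_of_ne_top ENNReal.coe_ne_top
  exact Varifold.isLocallyFiniteMeasure_map_graph _ _

/-- **The varifold `θ₀|S|` of an `m`-plane `S` with constant multiplicity `θ₀`** (as `ℝ≥0`, so that
the weight `θ₀ · H^m ⌞ S` is locally finite; `θ₀|S|` for `θ₀ > 0`, the zero varifold for `θ₀ = 0`).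
Tonegawa 2019, §1.3 and Prop. 1.14 (`V = θ|S|`, `S ∈ G(n, k)`). [cite: Tonegawa2019, Prop. 1.14, §1.6] -/
def Varifold.ofSubspace (hS : finrank ℝ S = m) (θ₀ : ℝ≥0) : Varifold V m :=
  haveI := isLocallyFiniteMeasure_map_plane S hS θ₀
  Varifold.ofMeasure m ((((θ₀ : ℝ≥0∞) • (μHE[m] : Measure V).restrict S)).map
    fun x ↦ (x, S.starProjection))

/-- The measure of `θ₀|S|` is the push-forward of `θ₀ · H^m ⌞ S` to the constant plane `S`.
[folklore] -/
theorem Varifold.toMeasure_ofSubspace (hS : finrank ℝ S = m) (θ₀ : ℝ≥0) :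
    (Varifold.ofSubspace S hS θ₀).toMeasure =
      (((θ₀ : ℝ≥0∞) • (μHE[m] : Measure V).restrict S)).map fun x ↦ (x, S.starProjection) := by
  haveI := isLocallyFiniteMeasure_map_plane S hS θ₀
  unfold Varifold.ofSubspace
  refine Varifold.ofMeasure_toMeasure_eq_self ?_
  rw [Measure.map_apply (measurable_prodMk_planeField measurable_const)
    (measurableSet_univ_prod_grassmannian m).compl]
  have : (fun x : V ↦ (x, S.starProjection)) ⁻¹' ((univ : Set V) ×ˢ grassmannian V m)ᶜ = ∅ := by
    ext x
    simpa using starProjection_mem_grassmannian S hS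
  rw [this, measure_empty]

/-- `θ₀|S|` is the rectifiable varifold of the data `(S, θ₀, P_S)`. [folklore] -/
theorem Varifold.toMeasure_ofSubspace_eq_rectifiableVarifoldMeasure (hS : finrank ℝ S = m)
    (θ₀ : ℝ≥0) :
    (Varifold.ofSubspace S hS θ₀).toMeasure =
      rectifiableVarifoldMeasure m (S : Set V) (fun _ ↦ (θ₀ : ℝ≥0∞)) (fun _ ↦ S.starProjection) := by
  rw [Varifold.toMeasure_ofSubspace, rectifiableVarifoldMeasure, withDensity_const]

/-- **The weight of `θ₀|S|` is `θ₀ · H^m ⌞ S`** (Tonegawa 2019, §1.3: `‖θ|Γ|‖ = θ H^k ⌞ Γ`).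
[cite: Tonegawa2019, §1.3, p. 8] -/
theorem Varifold.weight_ofSubspace (hS : finrank ℝ S = m) (θ₀ : ℝ≥0) :
    (Varifold.ofSubspace S hS θ₀).weight = (θ₀ : ℝ≥0∞) • (μHE[m] : Measure V).restrict S := by
  rw [Varifold.weight, Varifold.toMeasure_ofSubspace,
    Measure.map_map measurable_fst (measurable_prodMk_planeField measurable_const)]
  exact Measure.map_id

/-- **`θ₀|S|` is a rectifiable varifold** for `θ₀ > 0` (non-vacuity of `Varifold.IsRectifiable` by a
non-zero varifold). [cite: Tonegawa2019, Def. 1.6, §1.3] -/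
theorem Varifold.isRectifiable_ofSubspace (hS : finrank ℝ S = m) {θ₀ : ℝ≥0} (h0 : 0 < θ₀) :
    (Varifold.ofSubspace S hS θ₀).IsRectifiable :=
  ⟨S, fun _ ↦ θ₀, fun _ ↦ S.starProjection,
    isRectifiableVarifoldData_subspace S hS (by exact_mod_cast h0) ENNReal.coe_lt_top,
    Varifold.toMeasure_ofSubspace_eq_rectifiableVarifoldMeasure S hS θ₀⟩

/-- **`n|S|` is an integral varifold** for a positive integer multiplicity `n`.
[cite: Tonegawa2019, Def. 1.6, §1.3] -/
theorem Varifold.isIntegral_ofSubspace_natCast (hS : finrank ℝ S = m) {n : ℕ} (hn : 0 < n) :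
    (Varifold.ofSubspace S hS n).IsIntegral :=
  ⟨S, fun _ ↦ (n : ℝ≥0∞), fun _ ↦ S.starProjection,
    isRectifiableVarifoldData_subspace S hS (by exact_mod_cast hn) (ENNReal.natCast_lt_top n),
    ae_of_all _ fun _ ↦ ⟨n, rfl⟩,
    by simp only [Varifold.toMeasure_ofSubspace_eq_rectifiableVarifoldMeasure, ENNReal.coe_natCast]⟩

/-- **`|S|` is a unit-density varifold** (Tonegawa 2019, Def. 1.7). [cite: Tonegawa2019, Def. 1.7, §1.3] -/
theorem Varifold.isUnitDensity_ofSubspace_one (hS : finrank ℝ S = m) :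
    (Varifold.ofSubspace S hS 1).IsUnitDensity :=
  ⟨S, fun _ ↦ S.starProjection, isRectifiableVarifoldData_subspace S hS one_pos ENNReal.one_lt_top,
    by simpa using Varifold.toMeasure_ofSubspace_eq_rectifiableVarifoldMeasure S hS 1⟩

/-- **`|S| ≠ 0` for an `m`-plane with `m`-dimensional `S`, `m ≥ 0`**: its weight gives the plane
positive mass (`H^m(S) > 0`, as `S` carries a copy of Lebesgue measure of `ℝᵐ`). [folklore] -/
theorem Varifold.weight_ofSubspace_one_pos (hS : finrank ℝ S = m) :
    0 < (Varifold.ofSubspace S hS 1).weight (S : Set V) := by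
  rw [Varifold.weight_ofSubspace, ENNReal.coe_one, one_smul, Measure.restrict_apply_self,
    ← range_planeChart S hS, ← image_univ, (planeChart S hS).isometry.euclideanHausdorffMeasure_image,
    EuclideanSpace.euclideanHausdorffMeasure_eq_volume]
  exact lt_of_lt_of_le (Metric.measure_ball_pos volume (0 : EuclideanSpace ℝ (Fin m)) one_pos)
    (measure_mono (subset_univ _))

end Plane

end Literature.Geometry.GeometricMeasureTheory

end
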